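import Literature.ModelTheory.FiniteModelTheory.LFPSimulation
import Literature.ModelTheory.FiniteModelTheory.LFPCode
import Literature.ModelTheory.FiniteModelTheory.LFPEval
import HarnessLib

/-!
# `P ⊆ FO(IFP)` with order: every polynomial-time class of finite structures is definable
(discharge of `exists_sentence_natOrder_of_mem_P`)

Topic `Literature/ModelTheory/FiniteModelTheory`; step 4 (the last) of the discharge of the named
fact `Literature.ModelTheory.FiniteModelTheory.exists_sentence_natOrder_of_mem_P` of `LFP.lean`
(Gurevich 1984, §4 Theorems 2–3, (1) → (3); the hard half of the Immerman–Vardi theorem,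
Immerman 1986, Immerman 1999, Thm. 4.10; Vardi 1982; Libkin 2004, Thm. 10.14, second part:
"use the ordered `k`-tuples to model both positions of `M` and time … we assume that `nᵏ`
exceeds the size of the encodings of `n`-element structures … the sentence testing `𝒫` is
`∃p̄ ∃t̄ [ifp …](p̄, t̄)`"). We assemble

* the simulation induction of `LFPSimulation.lean` (`LFPSim.eval_accF`: the sentence `accF`
  holds iff the `FinTM2` run on the word `u` halts, before time `N ^ d`, with a designated symbol
  on top of the output stack), fed with
* the input builders of `LFPCode.lean` (`inLenT`, `inTrueT`: FO(IFP) with order reads the code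
  of its own structure, `u = code ⟨N, R⟩`),
* the unfolding of `L ∈ P` (`mem_P_iff_holds`: a machine `M` deciding `L` within `p(|u|)`
  steps; `TM2Sim.iterate_stepTotal_of_outputsWithin`: the run reaches the halting configuration
  with the answer bit on the output stack), and
* the choice of the tuple width `d` (`exists_width`): for all `N ≥ 2`,
  `|u| + D·p(|u|) + p(|u|) + D + 1 ≤ N ^ d` (time, stack heights, window size and code length
  below `N ^ d`; polynomial bounds `PolyBd` of `LFPEval.lean`),

into `accSentence_iff : accSentence holds in ⟨N, R⟩ ↔ code ⟨N, R⟩ ∈ L` for `N ≥ 2`. Structures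
with `N ≤ 1` elements (finitely many) are treated by brute force (`charF`, `smallSentence`:
a structure on `≤ 1` elements is determined by the truth values of its atoms), and the two are
combined by the first-order case distinction on the cardinality (`atMostOneF`):
`theorem exists_sentence_natOrder_of_mem_P_holds : exists_sentence_natOrder_of_mem_P`.
If the accepting output symbol can never occur on the output stack (`¬ IsSym`), the language is
empty and the small part alone defines the class.

## References

* Y. Gurevich, *Toward logic tailored for computational complexity*, LNM 1104 (1984), §4
  Theorems 2–3 ((1) → (3)).
* N. Immerman, *Relational queries computable in polynomial time*, Inform. and Control 68
  (1986); N. Immerman, *Descriptive Complexity*, Springer 1999, Thm. 4.10.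
* M. Y. Vardi, *The complexity of relational query languages*, STOC 1982, 137–146.
* L. Libkin, *Elements of Finite Model Theory*, Springer 2004, Thm. 10.14 (proof, second part).
-/

namespace Literature.ModelTheory.FiniteModelTheory

open _root_.Computability Literature.Computability.Complexity Literature.Computability.Complexity.Classes
  Literature.Computability.Cryptography

/-! ### Polynomial bounds below a power of the universe size -/

section Width

namespace LFPEval

/-- The binary length of `N` is polynomially bounded. [folklore] -/
theorem polyBd_length_encodeNat : PolyBd fun N => (encodeNat N).length :=
  PolyBd.of_le PolyBd.id fun N => by
    rw [TM2Pass.length_encodeNat_eq_size]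
    exact Nat.size_le.2 (Nat.lt_two_pow_self)

/-- The table offsets are polynomially bounded. [folklore] -/
theorem polyBd_boff (ar : List ℕ) : ∀ i : ℕ, PolyBd fun N => LFPCode.boff ar N i
  | 0 => PolyBd.const 0
  | i + 1 => PolyBd.add (polyBd_boff ar i) (PolyBd.pow _)

/-- The code length `clen ar N` is polynomially bounded. [folklore] -/
theorem polyBd_clen (ar : List ℕ) : PolyBd fun N => LFPCode.clen ar N :=
  PolyBd.add (PolyBd.add (PolyBd.mul (PolyBd.const 2) polyBd_length_encodeNat) (PolyBd.const 2))
    (polyBd_boff ar ar.length)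

/-- A polynomial of a polynomially bounded function is polynomially bounded. [folklore] -/
theorem PolyBd.eval_comp (p : Polynomial ℕ) {g : ℕ → ℕ} (hg : PolyBd g) : PolyBd fun N => p.eval (g N) := by
  obtain ⟨c, k, hck⟩ := exists_eval_le_mul_pow_add p
  obtain ⟨C, e, hCe⟩ := hg
  refine ⟨c * C ^ k + c, e * k, fun N => ?_⟩
  have h1 := hck (g N)
  have h2 : g N ^ k ≤ (C * (N + 1) ^ e) ^ k := Nat.pow_le_pow_left (hCe N) k
  rw [mul_pow, ← pow_mul] at h2
  have h3 : 1 ≤ (N + 1) ^ (e * k) := Nat.one_le_pow _ _ (Nat.succ_pos N)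
  calc p.eval (g N) ≤ c * g N ^ k + c := h1
    _ ≤ c * (C ^ k * (N + 1) ^ (e * k)) + c * (N + 1) ^ (e * k) := by
        apply Nat.add_le_add (Nat.mul_le_mul_left c h2); exact Nat.le_mul_of_pos_right c h3
    _ = (c * C ^ k + c) * (N + 1) ^ (e * k) := by ring

/-- A polynomially bounded function lies below a fixed power of `N` for all `N ≥ 2`. [folklore] -/
theorem PolyBd.exists_le_pow {f : ℕ → ℕ} (hf : PolyBd f) : ∃ d : ℕ, ∀ N, 2 ≤ N → f N ≤ N ^ d := by
  obtain ⟨C, e, hCe⟩ := hf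
  refine ⟨C + 2 * e, fun N hN => ?_⟩
  have h1 : C ≤ N ^ C := (Nat.lt_two_pow_self).le.trans (Nat.pow_le_pow_left hN C)
  have h2 : (N + 1) ^ e ≤ N ^ (2 * e) := by
    rw [pow_mul]; exact Nat.pow_le_pow_left (by nlinarith) e
  calc f N ≤ C * (N + 1) ^ e := hCe N
    _ ≤ N ^ C * N ^ (2 * e) := Nat.mul_le_mul h1 h2
    _ = N ^ (C + 2 * e) := (pow_add _ _ _).symm

/-- **Choice of the tuple width** (Libkin: "we assume that `nᵏ` exceeds the size of the encodings
of `n`-element structures"; here also the running time, the stack heights and the window size):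
`d ≥ 2`, `d` above all arities, and `clen + D·p(clen) + p(clen) + D + 1 ≤ N ^ d` for all `N ≥ 2`.
[Libkin 2004, proof of Thm. 10.14] [folklore] -/
theorem exists_width (ar : List ℕ) (p : Polynomial ℕ) (D : ℕ) :
    ∃ d : ℕ, 2 ≤ d ∧ (∀ a ∈ ar, a < d) ∧ ∀ N, 2 ≤ N →
      LFPCode.clen ar N + D * p.eval (LFPCode.clen ar N) + p.eval (LFPCode.clen ar N) + D + 1 ≤ N ^ d := by
  have hf : PolyBd fun N => LFPCode.clen ar N + D * p.eval (LFPCode.clen ar N) + p.eval (LFPCode.clen ar N) + D + 1 :=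
    PolyBd.add (PolyBd.add (PolyBd.add (PolyBd.add (polyBd_clen ar)
      (PolyBd.mul (PolyBd.const D) (PolyBd.eval_comp p (polyBd_clen ar)))) (PolyBd.eval_comp p (polyBd_clen ar)))
      (PolyBd.const D)) (PolyBd.const 1)
  obtain ⟨d₀, hd₀⟩ := PolyBd.exists_le_pow hf
  refine ⟨d₀ + ar.sum + 2, by omega, fun a ha => ?_, fun N hN => (hd₀ N hN).trans ?_⟩
  · have := List.le_sum_of_mem ha; omega
  · exact Nat.pow_le_pow_right (by omega) (by omega)

end LFPEval

end Width

/-! ### Small structures: cardinality tests and characteristic sentences -/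

section Small

variable {ar : List ℕ}

/-- "the universe is nonempty": `∃x ⊤`. [folklore] -/
def nonemptyF : Sentence (2 :: ar) := .ex .verum

/-- "the universe has at most one element": `∀x ∀y x = y`. [folklore] -/
def atMostOneF : Sentence (2 :: ar) := .all (.all (.eq 0 1))

/-- Semantics of `nonemptyF`. [folklore] -/
theorem holdsNat_nonemptyF {N : ℕ} (R : RelTables ar N) : (nonemptyF : Sentence (2 :: ar)).HoldsNat ⟨N, R⟩ ↔ 0 < N := by
  change Formula.eval _ _ _ _ ↔ _
  simp only [nonemptyF, Formula.eval, Formula.eval_verum, exists_const_iff, and_true]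
  exact ⟨fun ⟨a⟩ => a.pos, fun h => ⟨⟨0, h⟩⟩⟩

/-- Semantics of `atMostOneF`. [folklore] -/
theorem holdsNat_atMostOneF {N : ℕ} (R : RelTables ar N) : (atMostOneF : Sentence (2 :: ar)).HoldsNat ⟨N, R⟩ ↔ N ≤ 1 := by
  change Formula.eval _ _ _ _ ↔ _
  simp only [atMostOneF, Formula.eval]
  have e0 : ∀ a b : Fin N, (Fin.snoc (Fin.snoc (Fin.elim0 : Fin 0 → Fin N) a) b : Fin 2 → Fin N) 0 = a := fun a b => rfl
  have e1 : ∀ a b : Fin N, (Fin.snoc (Fin.snoc (Fin.elim0 : Fin 0 → Fin N) a) b : Fin 2 → Fin N) 1 = b := fun a b => rfl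
  simp only [e0, e1]
  constructor
  · intro h
    by_contra hN
    have := h ⟨0, by omega⟩ ⟨1, by omega⟩
    simp [Fin.ext_iff] at this
  · intro h a b
    apply Fin.ext; have := a.2; have := b.2; omega

/-- The CHARACTERISTIC SENTENCE of the tables `R₀` on `N₀` elements: some `N₀`-tuple of elements
`x̄` satisfies exactly the atoms `Rᵢ(x_{w 0}, …)` that are true of `R₀`. (For `N₀ ≤ 1` and a
universe of `N₀` elements this forces the tables to be `R₀`, `charF_iff_of_le_one`.) [folklore] -/
noncomputable def charF (N₀ : ℕ) (R₀ : RelTables ar N₀) : Sentence (2 :: ar) :=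
  Formula.exs N₀ (Formula.fAnd fun iw : (Σ i : Fin ar.length, (Fin (ar.get i) → Fin N₀)) =>
    if R₀ iw.1 iw.2 then Formula.tab iw.1 (fun l => Fin.natAdd 0 (iw.2 l))
    else .not (Formula.tab iw.1 (fun l => Fin.natAdd 0 (iw.2 l))))

/-- Semantics of `charF`: some valuation `a` of the tuple makes the atoms of `R` along `a` agree
with `R₀`. [folklore] -/
theorem holdsNat_charF {N₀ N : ℕ} (R₀ : RelTables ar N₀) (R : RelTables ar N) :
    (charF N₀ R₀).HoldsNat ⟨N, R⟩ ↔
      ∃ a : Fin N₀ → Fin N, ∀ (i : Fin ar.length) (w : Fin (ar.get i) → Fin N₀), R i (a ∘ w) = R₀ i w := by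
  change Formula.eval _ _ _ _ ↔ _
  simp only [charF, Formula.eval_exs, Formula.eval_fAnd, Sigma.forall]
  refine exists_congr fun a => forall_congr' fun i => forall_congr' fun w => ?_
  have e : (Fin.append (Fin.elim0 : Fin 0 → Fin N) a ∘ fun l => Fin.natAdd 0 (w l)) = a ∘ w := by
    funext l; simp
  split_ifs with h
  · rw [Formula.eval_tab, e, h]
  · rw [Formula.eval_not', Formula.eval_tab, e, Bool.not_eq_true]
    rw [Bool.not_eq_true] at h; rw [h]

/-- Self-maps of a type with at most one element are the identity. [folklore] -/
theorem eq_id_of_le_one {N₀ : ℕ} (hN₀ : N₀ ≤ 1) (a : Fin N₀ → Fin N₀) : a = id := by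
  funext x; apply Fin.ext; have := (a x).2; have := x.2; simp; omega

/-- For `N₀ ≤ 1`, the characteristic sentence of `R₀` holds in `⟨N₀, R⟩` iff `R = R₀`. [folklore] -/
theorem charF_iff_of_le_one {N₀ : ℕ} (hN₀ : N₀ ≤ 1) (R₀ R : RelTables ar N₀) :
    (charF N₀ R₀).HoldsNat ⟨N₀, R⟩ ↔ R = R₀ := by
  rw [holdsNat_charF]
  constructor
  · rintro ⟨a, ha⟩
    rw [eq_id_of_le_one hN₀ a] at ha
    funext i w; exact ha i w
  · rintro rfl; exact ⟨id, fun i w => rfl⟩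

/-- The tables on `N₀` elements whose structure lies in `C`, as a (finite) index type. [folklore] -/
abbrev SliceIdx (C : Set (SNPInstance ar)) (N₀ : ℕ) : Type :=
  {R₀ : RelTables ar N₀ // (⟨N₀, R₀⟩ : SNPInstance ar) ∈ C}

/-- **The brute-force sentence for structures with at most one element**:
`(N = 0 ∧ ⋁_{⟨0,R₀⟩ ∈ C} χ_{R₀}) ∨ (N = 1 ∧ ⋁_{⟨1,R₀⟩ ∈ C} χ_{R₀})`. [folklore] -/
noncomputable def smallSentence (C : Set (SNPInstance ar)) : Sentence (2 :: ar) :=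
  .or (.and (.not nonemptyF) (Formula.fOr fun R₀ : SliceIdx C 0 => charF 0 R₀.1))
    (.and nonemptyF (.and atMostOneF (Formula.fOr fun R₀ : SliceIdx C 1 => charF 1 R₀.1)))

/-- Semantics of `smallSentence` on structures with at most one element: membership in `C`. [folklore] -/
theorem holdsNat_smallSentence_of_le_one (C : Set (SNPInstance ar)) {N : ℕ} (hN : N ≤ 1) (R : RelTables ar N) :
    (smallSentence C).HoldsNat ⟨N, R⟩ ↔ (⟨N, R⟩ : SNPInstance ar) ∈ C := by
  have key : ∀ ψ χ : Sentence (2 :: ar), Sentence.HoldsNat (Formula.or ψ χ) ⟨N, R⟩ ↔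
      ψ.HoldsNat ⟨N, R⟩ ∨ χ.HoldsNat ⟨N, R⟩ := fun _ _ => Iff.rfl
  have keyA : ∀ ψ χ : Sentence (2 :: ar), Sentence.HoldsNat (Formula.and ψ χ) ⟨N, R⟩ ↔
      ψ.HoldsNat ⟨N, R⟩ ∧ χ.HoldsNat ⟨N, R⟩ := fun _ _ => Iff.rfl
  have keyN : ∀ ψ : Sentence (2 :: ar), Sentence.HoldsNat (Formula.not ψ) ⟨N, R⟩ ↔
      ¬ ψ.HoldsNat ⟨N, R⟩ := fun _ => Iff.rfl
  have keyO : ∀ {ι : Type} [Finite ι] (f : ι → Sentence (2 :: ar)),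
      Sentence.HoldsNat (Formula.fOr f) ⟨N, R⟩ ↔ ∃ i, (f i).HoldsNat ⟨N, R⟩ :=
    fun f => Formula.eval_fOr _ _ _ f
  simp only [smallSentence, key, keyA, keyN, keyO, holdsNat_nonemptyF, holdsNat_atMostOneF]
  rcases Nat.le_one_iff_eq_zero_or_eq_one.1 hN with rfl | rfl
  · simp only [lt_irrefl, not_false_eq_true, true_and, false_and, or_false]
    constructor
    · rintro ⟨⟨R₀, hR₀⟩, h⟩
      rw [charF_iff_of_le_one (by omega)] at h
      rw [h]; exact hR₀
    · intro h; exact ⟨⟨R, h⟩, (charF_iff_of_le_one (by omega) R R).2 rfl⟩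
  · simp only [Nat.lt_succ_self, not_true_eq_false, false_and, false_or, le_refl, true_and]
    constructor
    · rintro ⟨⟨R₀, hR₀⟩, h⟩
      rw [charF_iff_of_le_one le_rfl] at h
      rw [h]; exact hR₀
    · intro h; exact ⟨⟨R, h⟩, (charF_iff_of_le_one le_rfl R R).2 rfl⟩

/-- On structures with at least two elements `smallSentence` fails. [folklore] -/
theorem not_holdsNat_smallSentence (C : Set (SNPInstance ar)) {N : ℕ} (hN : 2 ≤ N) (R : RelTables ar N) :
    ¬ (smallSentence C).HoldsNat ⟨N, R⟩ := by
  change ¬ Formula.eval _ _ _ _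
  have h1 := (holdsNat_nonemptyF (ar := ar) R)
  have h2 := (holdsNat_atMostOneF (ar := ar) R)
  change Formula.eval _ _ _ _ ↔ _ at h1 h2
  simp only [smallSentence, Formula.eval_or', Formula.eval_and', Formula.eval_not', h1, h2]
  omega

end Small

/-! ### The acceptance sentence of a polynomial-time machine -/

section Acceptance

open Turing LFPSim

variable {ar : List ℕ} (M : TM2ComputableAux Bool Bool)

/-- **The acceptance sentence** of the machine `M` at tuple width `d`: the simulation sentence
`accF` of `LFPSimulation.lean` over the input builders `inLenT`/`inTrueT` of `LFPCode.lean`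
(the machine reads the code of the structure), the input alphabet of `M`, and the accepting
output symbol `γ₁`. [cite: Gurevich1984, §4 Theorems 2–3 ((1)→(3))] -/
noncomputable def accSentence {d : ℕ} (hd : 2 ≤ d) (hda : ∀ a ∈ ar, a < d) (γ₁ : LFPSim.Sym M.tm M.tm.k₁) :
    Sentence (2 :: ar) :=
  LFPSim.accF (tm := M.tm) (d := d) (fun _ _ _ p => LFPCode.inLenT hd hda p) (fun _ _ _ p => LFPCode.inTrueT hd hda p)
    M.inputAlphabet.symm γ₁

/-- The top of the output stack of the halting configuration. [folklore] -/
theorem cell_haltList_zero (tm : FinTM2) (γ : tm.Γ tm.k₁) :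
    LFPSim.cell tm (haltList tm [γ]) tm.k₁ 0 = FinTM2Sim.toSym tm tm.k₁ γ := by
  rw [LFPSim.cell_def]
  simp [haltList]

/-- The stacks of the initial configuration on `u` have height `≤ |u|`. [folklore] -/
theorem length_initList_stk_le (tm : FinTM2) (s : List (tm.Γ tm.k₀)) (k : tm.K) :
    ((initList tm s).stk k).length ≤ s.length := by
  simp only [initList]
  split_ifs with h
  · subst h; simp
  · simp

variable {L : Language Bool} {p : Polynomial ℕ}

/-- The run of a decider on `u` reaches, at time `p(|u|)`, the halting configuration carrying the
answer bit. [folklore] -/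
theorem run_eq_haltList (hM : DecidesInTime id L (fun a => p.eval a.length) M) (u : List Bool) :
    LFPSim.run M.tm (initList M.tm (u.map M.inputAlphabet.symm)) (p.eval u.length) =
      haltList M.tm [M.outputAlphabet.symm (L.boolIndicator u)] := by
  have h := TM2Sim.iterate_stepTotal_of_outputsWithin M (hM u)
  simpa [LFPSim.run, encodeBool] using h

/-- After halting the run stays put: for `t ≥ p(|u|)` the configuration is the halting one. [folklore] -/
theorem run_eq_haltList_of_le (hM : DecidesInTime id L (fun a => p.eval a.length) M) (u : List Bool) {t : ℕ}
    (ht : p.eval u.length ≤ t) :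
    LFPSim.run M.tm (initList M.tm (u.map M.inputAlphabet.symm)) t =
      haltList M.tm [M.outputAlphabet.symm (L.boolIndicator u)] := by
  obtain ⟨s, rfl⟩ := Nat.exists_eq_add_of_le ht
  rw [LFPSim.run, add_comm, Function.iterate_add_apply]
  change (TM2Sim.stepTotal M.tm)^[s] (LFPSim.run M.tm _ (p.eval u.length)) = _
  rw [run_eq_haltList M hM u, TM2Sim.iterate_stepTotal_of_none _ (TM2Sim.haltList_l _ _)]

/-- The stack heights of the run are bounded by `|u| + D · p(|u|) + 1` at all times. [folklore] -/
theorem length_run_stk_le (hM : DecidesInTime id L (fun a => p.eval a.length) M) (u : List Bool) (t : ℕ) (k : M.tm.K) :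
    ((LFPSim.run M.tm (initList M.tm (u.map M.inputAlphabet.symm)) t).stk k).length ≤
      u.length + LFPSim.D M.tm * p.eval u.length + 1 := by
  rcases le_or_gt t (p.eval u.length) with ht | ht
  · refine (TM2Sim.length_iterate_stepTotal_le M.tm _ k t).trans (Nat.le_succ_of_le ?_)
    have := length_initList_stk_le M.tm (u.map M.inputAlphabet.symm) k
    rw [List.length_map] at this
    exact Nat.add_le_add this (Nat.mul_le_mul_left _ ht)
  · rw [run_eq_haltList_of_le M hM u ht.le]
    simp only [haltList]
    split_ifs with h
    · subst h; simp
    · simp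

/-- If the accepting symbol is not an effective symbol of the output stack, nothing is accepted. [folklore] -/
theorem not_mem_of_not_isSym (hM : DecidesInTime id L (fun a => p.eval a.length) M)
    (hsym : ¬ TM2Sim.IsSym M.tm M.tm.k₁ (M.outputAlphabet.symm true)) (u : List Bool) : u ∉ L := by
  intro hu
  have hgood := TM2Sim.Good.iterate M.tm (TM2Sim.good_initList M.tm (u.map M.inputAlphabet.symm)) (p.eval u.length)
  change TM2Sim.Good M.tm (LFPSim.run M.tm _ _) at hgood
  rw [run_eq_haltList M hM u, (Set.mem_iff_boolIndicator _ _).1 hu] at hgood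
  exact hsym (hgood M.tm.k₁ _ (by simp [haltList]))

/-- **Semantics of the acceptance sentence** on a structure with `N ≥ 2` elements, for a width
`d` with `|code| + D·p(|code|) + p(|code|) + D + 1 ≤ N ^ d`: it holds iff the code of the
structure is in `L`. [Libkin 2004, proof of Thm. 10.14; Gurevich 1984, §4 Theorems 2–3]
[cite: Gurevich1984, §4 Theorems 2–3 ((1)→(3))] -/
theorem accSentence_iff (hM : DecidesInTime id L (fun a => p.eval a.length) M) {d : ℕ} (hd : 2 ≤ d)
    (hda : ∀ a ∈ ar, a < d) (hsym : TM2Sim.IsSym M.tm M.tm.k₁ (M.outputAlphabet.symm true))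
    {N : ℕ} (hN : 2 ≤ N) (R : RelTables ar N)
    (hbd : LFPCode.clen ar N + LFPSim.D M.tm * p.eval (LFPCode.clen ar N) + p.eval (LFPCode.clen ar N) +
      LFPSim.D M.tm + 1 ≤ N ^ d) :
    (accSentence M hd hda ⟨_, hsym⟩).HoldsNat ⟨N, R⟩ ↔ codeOf R ∈ L := by
  have hlen : (codeOf R).length = LFPCode.clen ar N := LFPCode.length_codeOf_eq_clen R
  have hbig : LFPCode.clen ar N < N ^ d := by omega
  change Formula.eval _ _ _ _ ↔ _
  rw [accSentence, LFPSim.eval_accF (u := codeOf R) R _ _ (by omega) hN (by omega) M.inputAlphabet.symm ⟨_, hsym⟩]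
  rotate_left
  · intro rv' m V' τ ι y
    rw [hlen]; exact LFPCode.eval_inLenT R V' hd hda hN hbig τ y
  · intro rv' m V' τ ι y
    exact LFPCode.eval_inTrueT R V' hd hda hN hbig τ y
  · intro t _ k
    refine (length_run_stk_le M hM (codeOf R) t k).trans ?_
    rw [hlen]; omega
  -- the run halts at time `p(|code|) < N ^ d` with the answer bit on the output stack
  have hT : p.eval (codeOf R).length < N ^ d := by rw [hlen]; omega
  constructor
  · rintro ⟨t, -, hl, hc⟩
    have hfix : LFPSim.run M.tm (initList M.tm ((codeOf R).map M.inputAlphabet.symm)) t =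
        haltList M.tm [M.outputAlphabet.symm (L.boolIndicator (codeOf R))] := by
      rcases le_or_gt (p.eval (codeOf R).length) t with ht | ht
      · exact run_eq_haltList_of_le M hM _ ht
      · have h1 := LFPSim.run_fixed_of_halted (tm := M.tm) _ hl (p.eval (codeOf R).length) ht.le
        rw [← h1]; exact run_eq_haltList M hM _
    rw [hfix, cell_haltList_zero, Tableau.toSym_eq_some_iff] at hc
    have hb : L.boolIndicator (codeOf R) = true := M.outputAlphabet.symm.injective hc.symm
    exact (Set.mem_iff_boolIndicator _ _).2 hb
  · intro hu
    refine ⟨p.eval (codeOf R).length, hT, ?_, ?_⟩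
    · rw [run_eq_haltList M hM]; rfl
    · rw [run_eq_haltList M hM, cell_haltList_zero, (Set.mem_iff_boolIndicator _ _).1 hu]
      exact FinTM2Sim.toSym_of_isSym M.tm hsym

end Acceptance

/-! ### Assembly -/

section Assembly

open Turing

variable {ar : List ℕ}

/-- Membership of a structure in a class is membership of its code in the language of codes. [folklore] -/
theorem codeOf_mem_toLanguage_iff (C : Set (SNPInstance ar)) {N : ℕ} (R : RelTables ar N) :
    codeOf R ∈ (encodingSNPInstance ar).toLanguage C ↔ (⟨N, R⟩ : SNPInstance ar) ∈ C :=
  ((encodingSNPInstance ar).encode_injective).mem_set_image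

/-- **`P ⊆ FO(IFP)` with order** (discharge of the named fact `exists_sentence_natOrder_of_mem_P`
of `LFP.lean`): for every vocabulary with a symbol of arity `≥ 1` and every class `C` of finite
structures whose language of codes is in `P`, some sentence of FO(IFP) with the natural order
defines `C`. The sentence is `(¬ atMostOne ∧ accSentence M d) ∨ smallSentence C` for a
polynomial-time decider `M` of the language and a suitable width `d` (or `smallSentence C` alone
if `M` can never print the accepting symbol). [Gurevich 1984, §4 Theorems 2–3 ((1) → (3));
Immerman 1986; Immerman 1999, Thm. 4.10; Vardi 1982; Libkin 2004, Thm. 10.14]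
[cite: Gurevich1984, §4 Theorems 2–3 ((1)→(3))] -/
theorem exists_sentence_natOrder_of_mem_P_holds : exists_sentence_natOrder_of_mem_P := by
  intro ar _ C hC
  obtain ⟨p, M, hM⟩ := mem_P_iff_holds.1 hC
  obtain ⟨d, hd, hda, hbd⟩ := LFPEval.exists_width ar p (LFPSim.D M.tm)
  by_cases hsym : TM2Sim.IsSym M.tm M.tm.k₁ (M.outputAlphabet.symm true)
  · refine ⟨.or (.and (.not atMostOneF) (accSentence M hd hda ⟨_, hsym⟩)) (smallSentence C), ?_⟩
    ext ⟨N, R⟩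
    change ((¬ (atMostOneF : Sentence (2 :: ar)).HoldsNat ⟨N, R⟩ ∧ (accSentence M hd hda ⟨_, hsym⟩).HoldsNat ⟨N, R⟩) ∨
      (smallSentence C).HoldsNat ⟨N, R⟩) ↔ _
    rw [holdsNat_atMostOneF]
    rcases le_or_gt N 1 with hN | hN
    · rw [holdsNat_smallSentence_of_le_one C hN]
      simp [hN]
    · rw [accSentence_iff M hM hd hda hsym hN R (hbd N hN), codeOf_mem_toLanguage_iff]
      have := not_holdsNat_smallSentence C hN R
      constructor
      · rintro (⟨-, h⟩ | h)
        · exact h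
        · exact absurd h this
      · intro h; exact Or.inl ⟨by omega, h⟩
  · refine ⟨smallSentence C, ?_⟩
    ext ⟨N, R⟩
    change (smallSentence C).HoldsNat ⟨N, R⟩ ↔ _
    rcases le_or_gt N 1 with hN | hN
    · exact holdsNat_smallSentence_of_le_one C hN R
    · constructor
      · intro h; exact absurd h (not_holdsNat_smallSentence C hN R)
      · intro h
        exact absurd ((codeOf_mem_toLanguage_iff C R).2 h) (not_mem_of_not_isSym M hM hsym (codeOf R))

end Assembly

end Literature.ModelTheory.FiniteModelTheory
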